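import Literature.Probability.Percolation.QuadCrossingSquareModel
import Literature.Probability.RandomPlanarGeometry.PolygonalDomains

/-!
# Simple lattice cycles of `δℤ²` are simple closed rectilinear polygons

Support file for `RectilinearSuffices` (route CardyBoundaryCoulombGas of `CardyFormulaZ2`,
item stmt-CriticalPhenomena-5663). A cyclic list of pairwise distinct sites of `ℤ²` in which
cyclically consecutive sites are nearest neighbours, drawn at mesh `h > 0` (`meshPoint h`), spans
a simple closed polygon in the sense of `IsSimpleClosedPolygon` (`isSimpleClosedPolygon_meshCycle`),
all of whose edges are axis-parallel. The geometric input is that two distinct unit edges of the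
lattice meet at most in a common endpoint (`lattice_edges_inter`).
-/

noncomputable section

namespace Summit.CriticalPhenomena.CardyFormulaZ2.Theorems

open Set Complex
open Literature.Probability.LatticeModels Literature.Probability.Percolation
open Literature.Probability.RandomPlanarGeometry

/-! ### Unit edges of the lattice -/

/-- `meshPoint h` is injective for `h ≠ 0`. [folklore] -/
theorem meshPoint_injective {h : ℝ} (hh : h ≠ 0) : Function.Injective (meshPoint h) :=
  fun x y hxy => by rw [← nearestSite_meshPoint hh x, hxy, nearestSite_meshPoint hh y]

/-- The mesh point of a translated site, in coordinates. [folklore] -/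
theorem meshPoint_add_single (h : ℝ) (u : Site 2) (i : Fin 2) :
    (meshPoint h (u + Pi.single i 1)).re = h * u 0 + h * ((Pi.single i (1 : ℤ) : Site 2) 0) ∧
      (meshPoint h (u + Pi.single i 1)).im = h * u 1 + h * ((Pi.single i (1 : ℤ) : Site 2) 1) := by
  simp only [meshPoint_re, meshPoint_im, Pi.add_apply, Int.cast_add]
  constructor <;> ring

/-- A point of a horizontal unit edge `[u, u + e₀]`, in coordinates. [folklore] -/
theorem mem_segment_horizontal {h : ℝ} (hh : 0 < h) {u : Site 2} {z : ℂ}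
    (hz : z ∈ segment ℝ (meshPoint h u) (meshPoint h (u + Pi.single 0 1))) :
    z.im = h * u 1 ∧ h * u 0 ≤ z.re ∧ z.re ≤ h * u 0 + h := by
  obtain ⟨hre, him⟩ := meshPoint_add_single h u 0
  simp only [Pi.single_eq_same, Int.cast_one, mul_one, Fin.isValue, ne_eq, one_ne_zero,
    not_false_eq_true, Pi.single_eq_of_ne, Int.cast_zero, mul_zero, add_zero] at hre him
  rw [mem_segment_iff_of_im_eq (by rw [meshPoint_re, hre]; linarith) (by rw [meshPoint_im, him])] at hz
  rw [meshPoint_im, meshPoint_re, hre] at hz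
  exact ⟨hz.1, hz.2.1, hz.2.2⟩

/-- A point of a vertical unit edge `[u, u + e₁]`, in coordinates. [folklore] -/
theorem mem_segment_vertical {h : ℝ} (hh : 0 < h) {u : Site 2} {z : ℂ}
    (hz : z ∈ segment ℝ (meshPoint h u) (meshPoint h (u + Pi.single 1 1))) :
    z.re = h * u 0 ∧ h * u 1 ≤ z.im ∧ z.im ≤ h * u 1 + h := by
  obtain ⟨hre, him⟩ := meshPoint_add_single h u 1
  simp only [Fin.isValue, ne_eq, zero_ne_one, not_false_eq_true, Pi.single_eq_of_ne, Int.cast_zero,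
    mul_zero, add_zero, Pi.single_eq_same, Int.cast_one, mul_one] at hre him
  rw [mem_segment_iff_of_re_eq (by rw [meshPoint_im, him]; linarith) (by rw [meshPoint_re, hre])] at hz
  rw [meshPoint_re, meshPoint_im, him] at hz
  exact ⟨hz.1, hz.2.1, hz.2.2⟩

/-- An integer in a unit interval `[m, m+1]` is one of its ends. [folklore] -/
theorem int_eq_or_eq_of_mem_Icc {a m : ℤ} (h1 : (m : ℝ) ≤ a) (h2 : (a : ℝ) ≤ m + 1) :
    a = m ∨ a = m + 1 := by
  have h1' : m ≤ a := by exact_mod_cast h1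
  have h2' : a ≤ m + 1 := by exact_mod_cast h2
  omega

/-- Reconstructing a mesh point from its coordinates. [folklore] -/
theorem eq_meshPoint_of_re_im {h : ℝ} {z : ℂ} {a b : ℤ} (hre : z.re = h * a) (him : z.im = h * b) :
    z = meshPoint h ![a, b] :=
  Complex.ext (by rw [meshPoint_re, hre]; rfl) (by rw [meshPoint_im, him]; rfl)

/-- The far end of a unit edge as an explicit site. [folklore] -/
theorem add_single_zero_eq (u : Site 2) : u + Pi.single 0 1 = ![u 0 + 1, u 1] := by
  ext i; fin_cases i <;> simp
/-- The far end of a unit edge as an explicit site. [folklore] -/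
theorem add_single_one_eq (u : Site 2) : u + Pi.single 1 1 = ![u 0, u 1 + 1] := by
  ext i; fin_cases i <;> simp
/-- A site as an explicit pair. [folklore] -/
theorem site_eq_vec (u : Site 2) : u = ![u 0, u 1] := by
  ext i; fin_cases i <;> simp

/-- **Two unit edges of the lattice meet at most in a common endpoint**, unless they coincide:
a common point of the closed edges `[u, u + eᵢ]` and `[v, v + eⱼ]` of `hℤ²` is an endpoint of
both, or `(u, i) = (v, j)`. [folklore] -/
theorem lattice_unit_edges_inter {h : ℝ} (hh : 0 < h) {u v : Site 2} {i j : Fin 2} {z : ℂ}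
    (hz : z ∈ segment ℝ (meshPoint h u) (meshPoint h (u + Pi.single i 1)))
    (hz' : z ∈ segment ℝ (meshPoint h v) (meshPoint h (v + Pi.single j 1))) :
    ((z = meshPoint h u ∨ z = meshPoint h (u + Pi.single i 1)) ∧
      (z = meshPoint h v ∨ z = meshPoint h (v + Pi.single j 1))) ∨ (u = v ∧ i = j) := by
  have hcast : ∀ {a b : ℤ}, h * a = h * b → a = b := fun hab =>
    by exact_mod_cast mul_left_cancel₀ hh.ne' hab
  have hle : ∀ {a b : ℤ}, h * a ≤ h * b → a ≤ b := fun hab =>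
    by exact_mod_cast le_of_mul_le_mul_left hab hh
  fin_cases i <;> fin_cases j
  · -- horizontal / horizontal
    simp only [Fin.zero_eta, Fin.isValue] at hz hz' ⊢
    obtain ⟨hi1, hr1, hr2⟩ := mem_segment_horizontal hh hz
    obtain ⟨hi2, hr3, hr4⟩ := mem_segment_horizontal hh hz'
    have h11 : u 1 = v 1 := hcast (hi1.symm.trans hi2)
    by_cases h00 : u 0 = v 0
    · right; exact ⟨by rw [site_eq_vec u, site_eq_vec v, h00, h11], by simp⟩
    left
    rcases lt_or_gt_of_ne h00 with hlt | hlt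
    · have hv : (u 0 : ℝ) + 1 ≤ v 0 := by exact_mod_cast hlt
      have hzre : z.re = h * v 0 := by nlinarith
      have hzre' : z.re = h * (u 0 + 1) := by nlinarith
      refine ⟨Or.inr ?_, Or.inl ?_⟩
      · rw [add_single_zero_eq]; exact eq_meshPoint_of_re_im (by rw [hzre']; push_cast; ring) hi1
      · rw [site_eq_vec v]; exact eq_meshPoint_of_re_im hzre hi2
    · have hv : (v 0 : ℝ) + 1 ≤ u 0 := by exact_mod_cast hlt
      have hzre : z.re = h * u 0 := by nlinarith
      have hzre' : z.re = h * (v 0 + 1) := by nlinarith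
      refine ⟨Or.inl ?_, Or.inr ?_⟩
      · rw [site_eq_vec u]; exact eq_meshPoint_of_re_im hzre hi1
      · rw [add_single_zero_eq]; exact eq_meshPoint_of_re_im (by rw [hzre']; push_cast; ring) hi2
  · -- horizontal / vertical
    simp only [Fin.zero_eta, Fin.isValue, Fin.mk_one] at hz hz' ⊢
    left
    obtain ⟨hi1, hr1, hr2⟩ := mem_segment_horizontal hh hz
    obtain ⟨hr3, hi3, hi4⟩ := mem_segment_vertical hh hz'
    have ha : v 0 = u 0 ∨ v 0 = u 0 + 1 := by
      refine int_eq_or_eq_of_mem_Icc (le_of_mul_le_mul_left (by rw [← hr3]; exact hr1) hh)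
        (le_of_mul_le_mul_left (a := h) ?_ hh)
      rw [← hr3]; linarith
    have hb : u 1 = v 1 ∨ u 1 = v 1 + 1 := by
      refine int_eq_or_eq_of_mem_Icc (le_of_mul_le_mul_left (by rw [← hi1]; exact hi3) hh)
        (le_of_mul_le_mul_left (a := h) ?_ hh)
      rw [← hi1]; linarith
    constructor
    · rcases ha with ha | ha
      · left; rw [site_eq_vec u]; exact eq_meshPoint_of_re_im (by rw [hr3, ha]) hi1
      · right; rw [add_single_zero_eq]; exact eq_meshPoint_of_re_im (by rw [hr3, ha]) hi1
    · rcases hb with hb | hb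
      · left; rw [site_eq_vec v]; exact eq_meshPoint_of_re_im hr3 (by rw [hi1, hb])
      · right; rw [add_single_one_eq]; exact eq_meshPoint_of_re_im hr3 (by rw [hi1, hb])
  · -- vertical / horizontal
    simp only [Fin.zero_eta, Fin.isValue, Fin.mk_one] at hz hz' ⊢
    left
    obtain ⟨hr1, hi1, hi2⟩ := mem_segment_vertical hh hz
    obtain ⟨hi3, hr3, hr4⟩ := mem_segment_horizontal hh hz'
    have ha : u 0 = v 0 ∨ u 0 = v 0 + 1 := by
      refine int_eq_or_eq_of_mem_Icc (le_of_mul_le_mul_left (by rw [← hr1]; exact hr3) hh)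
        (le_of_mul_le_mul_left (a := h) ?_ hh)
      rw [← hr1]; linarith
    have hb : v 1 = u 1 ∨ v 1 = u 1 + 1 := by
      refine int_eq_or_eq_of_mem_Icc (le_of_mul_le_mul_left (by rw [← hi3]; exact hi1) hh)
        (le_of_mul_le_mul_left (a := h) ?_ hh)
      rw [← hi3]; linarith
    constructor
    · rcases hb with hb | hb
      · left; rw [site_eq_vec u]; exact eq_meshPoint_of_re_im hr1 (by rw [hi3, hb])
      · right; rw [add_single_one_eq]; exact eq_meshPoint_of_re_im hr1 (by rw [hi3, hb])
    · rcases ha with ha | ha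
      · left; rw [site_eq_vec v]; exact eq_meshPoint_of_re_im (by rw [hr1, ha]) hi3
      · right; rw [add_single_zero_eq]; exact eq_meshPoint_of_re_im (by rw [hr1, ha]) hi3
  · -- vertical / vertical
    simp only [Fin.isValue, Fin.mk_one] at hz hz' ⊢
    obtain ⟨hr1, hi1, hi2⟩ := mem_segment_vertical hh hz
    obtain ⟨hr2, hi3, hi4⟩ := mem_segment_vertical hh hz'
    have h00 : u 0 = v 0 := hcast (hr1.symm.trans hr2)
    by_cases h11 : u 1 = v 1
    · right; exact ⟨by rw [site_eq_vec u, site_eq_vec v, h00, h11], by simp⟩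
    left
    rcases lt_or_gt_of_ne h11 with hlt | hlt
    · have hv : (u 1 : ℝ) + 1 ≤ v 1 := by exact_mod_cast hlt
      have hzim : z.im = h * v 1 := by nlinarith
      have hzim' : z.im = h * (u 1 + 1) := by nlinarith
      refine ⟨Or.inr ?_, Or.inl ?_⟩
      · rw [add_single_one_eq]; exact eq_meshPoint_of_re_im hr1 (by rw [hzim']; push_cast; ring)
      · rw [site_eq_vec v]; exact eq_meshPoint_of_re_im hr2 hzim
    · have hv : (v 1 : ℝ) + 1 ≤ u 1 := by exact_mod_cast hlt
      have hzim : z.im = h * u 1 := by nlinarith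
      have hzim' : z.im = h * (v 1 + 1) := by nlinarith
      refine ⟨Or.inl ?_, Or.inr ?_⟩
      · rw [site_eq_vec u]; exact eq_meshPoint_of_re_im hr1 hzim
      · rw [add_single_one_eq]; exact eq_meshPoint_of_re_im hr2 (by rw [hzim']; push_cast; ring)

/-- **Two lattice edges meet at most in a common endpoint**, unless they are the same edge. For
nearest neighbours `x ∼ y`, `x' ∼ y'` of `ℤ²`, a common point of the closed mesh edges `[x, y]`
and `[x', y']` is an endpoint of both, or `{x, y} = {x', y'}`. [folklore] -/
theorem lattice_edges_inter {h : ℝ} (hh : 0 < h) {x y x' y' : Site 2} (hxy : (zdGraph 2).Adj x y)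
    (hxy' : (zdGraph 2).Adj x' y') {z : ℂ} (hz : z ∈ segment ℝ (meshPoint h x) (meshPoint h y))
    (hz' : z ∈ segment ℝ (meshPoint h x') (meshPoint h y')) :
    ((z = meshPoint h x ∨ z = meshPoint h y) ∧ (z = meshPoint h x' ∨ z = meshPoint h y')) ∨
      (x = x' ∧ y = y') ∨ (x = y' ∧ y = x') := by
  rw [zdGraph_adj_iff] at hxy hxy'
  obtain ⟨i, hi⟩ := hxy
  obtain ⟨j, hj⟩ := hxy'
  -- normalise both edges as `[u, u + eᵢ]`, `[v, v + eⱼ]`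
  obtain ⟨u, hu, hzu⟩ : ∃ u : Site 2, ((x = u ∧ y = u + Pi.single i 1) ∨ (y = u ∧ x = u + Pi.single i 1)) ∧
      z ∈ segment ℝ (meshPoint h u) (meshPoint h (u + Pi.single i 1)) := by
    rcases hi with h1 | h1
    · exact ⟨x, Or.inl ⟨rfl, h1⟩, h1 ▸ hz⟩
    · exact ⟨y, Or.inr ⟨rfl, h1⟩, by rw [segment_symm] at hz; exact h1 ▸ hz⟩
  obtain ⟨v, hv, hzv⟩ : ∃ v : Site 2, ((x' = v ∧ y' = v + Pi.single j 1) ∨ (y' = v ∧ x' = v + Pi.single j 1)) ∧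
      z ∈ segment ℝ (meshPoint h v) (meshPoint h (v + Pi.single j 1)) := by
    rcases hj with h1 | h1
    · exact ⟨x', Or.inl ⟨rfl, h1⟩, h1 ▸ hz'⟩
    · exact ⟨y', Or.inr ⟨rfl, h1⟩, by rw [segment_symm] at hz'; exact h1 ▸ hz'⟩
  rcases lattice_unit_edges_inter hh hzu hzv with ⟨h1, h2⟩ | ⟨rfl, rfl⟩
  · left
    constructor
    · rcases hu with ⟨rfl, rfl⟩ | ⟨rfl, rfl⟩
      · exact h1
      · exact h1.symm
    · rcases hv with ⟨rfl, rfl⟩ | ⟨rfl, rfl⟩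
      · exact h2
      · exact h2.symm
  · right
    rcases hu with ⟨rfl, rfl⟩ | ⟨rfl, rfl⟩ <;> rcases hv with ⟨rfl, rfl⟩ | ⟨rfl, rfl⟩
    · exact Or.inl ⟨rfl, rfl⟩
    · exact Or.inr ⟨rfl, rfl⟩
    · exact Or.inr ⟨rfl, rfl⟩
    · exact Or.inl ⟨rfl, rfl⟩

/-- The right end of a non-degenerate half-open segment is not on it. [folklore] -/
theorem right_not_mem_icoSegment {p q : ℂ} (hpq : p ≠ q) : q ∉ icoSegment p q := by
  rintro ⟨θ, hθ, h⟩
  rw [AffineMap.lineMap_apply_module'] at h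
  have : (1 - θ) • (q - p) = 0 := by
    rw [sub_smul, one_smul]
    have h' : θ • (q - p) + p - q = 0 := by rw [h, sub_self]
    linear_combination (norm := module) -h'
  rcases smul_eq_zero.1 this with h1 | h1
  · linarith [hθ.2]
  · exact hpq (sub_eq_zero.1 h1).symm

/-! ### Simple lattice cycles -/

/-- **A simple lattice cycle spans a simple closed polygon.** A cyclic list of `≥ 3` pairwise
distinct sites of `ℤ²` with cyclically consecutive sites adjacent, drawn at mesh `h > 0`, satisfies
`IsSimpleClosedPolygon`. [folklore] -/
theorem isSimpleClosedPolygon_meshCycle {h : ℝ} (hh : 0 < h) {q : List (Site 2)} (hq : 3 ≤ q.length)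
    (hnodup : ∀ (i j : ℕ) (hi : i < q.length) (hj : j < q.length), q[i] = q[j] → i = j)
    (hadj : ∀ (i : ℕ) (hi : i < q.length),
      (zdGraph 2).Adj q[i] (q[(i + 1) % q.length]'(Nat.mod_lt _ (by omega)))) :
    IsSimpleClosedPolygon (q.map (meshPoint h)) := by
  set n := q.length with hn
  have hlen : (q.map (meshPoint h)).length = n := by rw [List.length_map]
  have hget : ∀ (k : ℕ) (hk : k < (q.map (meshPoint h)).length),
      (q.map (meshPoint h))[k] = meshPoint h (q[k]'(by rw [hlen] at hk; exact hk)) :=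
    fun k hk => List.getElem_map _
  have hinj := meshPoint_injective hh.ne'
  refine IsSimpleClosedPolygon.of_lt (by rw [hlen]; omega) (fun k hk => ?_) (fun i j hi hj hij => ?_)
  · rw [hget, hget]
    intro heq
    have := hinj heq
    simp only [hlen] at this
    exact (hadj k (by rw [hlen] at hk; exact hk)).ne this
  · rw [Set.disjoint_left]
    intro z hz hz'
    have hi' : i < n := by rw [hlen] at hi; exact hi
    have hj' : j < n := by rw [hlen] at hj; exact hj
    have hzc := icoSegment_subset_segment _ _ hz
    have hzc' := icoSegment_subset_segment _ _ hz'
    rw [hget, hget] at hzc hzc' hz hz'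
    simp only [hlen] at hzc hzc' hz hz'
    have hA := lattice_edges_inter hh (hadj i hi') (hadj j hj') hzc hzc'
    -- the indices of the far ends
    have hi1 : (i + 1) % n < n := Nat.mod_lt _ (by omega)
    have hj1 : (j + 1) % n < n := Nat.mod_lt _ (by omega)
    rcases hA with ⟨h1, h2⟩ | ⟨h1, -⟩ | ⟨h1, h2⟩
    · -- a common endpoint: it is the left end of both half-open edges, so `q i = q j`
      have hzi : z = meshPoint h q[i] := by
        rcases h1 with h1 | h1
        · exact h1
        · exfalso
          refine right_not_mem_icoSegment ?_ (h1 ▸ hz)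
          intro heq
          exact (hadj i hi').ne (hinj heq)
      have hzj : z = meshPoint h q[j] := by
        rcases h2 with h2 | h2
        · exact h2
        · exfalso
          refine right_not_mem_icoSegment ?_ (h2 ▸ hz')
          intro heq
          exact (hadj j hj').ne (hinj heq)
      have := hnodup i j hi' hj' (hinj (hzi.symm.trans hzj))
      omega
    · have := hnodup i j hi' hj' h1
      omega
    · -- the same edge traversed backwards: only possible for a `2`-cycle
      have e1 : i = (j + 1) % n := hnodup _ _ hi' hj1 h1
      have e2 : (i + 1) % n = j := hnodup _ _ hi1 hj' h2
      by_cases hjn : j + 1 < n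
      · rw [Nat.mod_eq_of_lt hjn] at e1; omega
      · have hjn' : j + 1 = n := by omega
        rw [hjn', Nat.mod_self] at e1
        subst e1
        rw [Nat.mod_eq_of_lt (by omega : 0 + 1 < n)] at e2
        omega

/-- The edges of a lattice cycle are axis-parallel: the drawn polygon lies in finitely many
axis-parallel segments. [folklore] -/
theorem exists_axisParallel_cover {h : ℝ} {q : List (Site 2)} (hq : 0 < q.length)
    (hadj : ∀ (i : ℕ) (hi : i < q.length),
      (zdGraph 2).Adj q[i] (q[(i + 1) % q.length]'(Nat.mod_lt _ hq))) :
    ∃ S : Finset (ℂ × ℂ), (∀ p ∈ S, p.1.re = p.2.re ∨ p.1.im = p.2.im) ∧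
      range (polygonLoop (q.map (meshPoint h))) ⊆ ⋃ p ∈ S, segment ℝ p.1 p.2 := by
  classical
  have hl : q.map (meshPoint h) ≠ [] := by
    intro h0; rw [List.map_eq_nil_iff] at h0; rw [h0] at hq; simp at hq
  refine ⟨(Finset.range q.length).image fun k =>
      (meshPoint h (q[k % q.length]'(Nat.mod_lt _ hq)),
        meshPoint h (q[(k % q.length + 1) % q.length]'(Nat.mod_lt _ hq))), ?_, ?_⟩
  · intro p hp
    simp only [Finset.mem_image, Finset.mem_range] at hp
    obtain ⟨k, hk, rfl⟩ := hp
    have hadj' := hadj (k % q.length) (Nat.mod_lt _ hq)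
    rw [zdGraph_adj_iff] at hadj'
    obtain ⟨i, hi | hi⟩ := hadj'
    · simp only [hi, meshPoint_re, meshPoint_im, Pi.add_apply, Int.cast_add]
      fin_cases i
      · right; simp
      · left; simp
    · simp only [meshPoint_re, meshPoint_im]
      conv_lhs => rw [hi]
      conv_rhs => arg 1; rw [hi]
      simp only [Pi.add_apply, Int.cast_add]
      fin_cases i
      · right; simp
      · left; simp
  · rw [range_polygonLoop hl]
    intro z hz
    simp only [mem_iUnion] at hz ⊢
    obtain ⟨k, hk⟩ := hz
    have hkq : (k : ℕ) < q.length := by simpa using k.2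
    refine ⟨_, Finset.mem_image.2 ⟨k, Finset.mem_range.2 hkq, rfl⟩, ?_⟩
    simp only [List.getElem_map, List.length_map, Nat.mod_eq_of_lt hkq] at hk ⊢
    exact hk

end Summit.CriticalPhenomena.CardyFormulaZ2.Theorems
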